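import Mathlib
import HarnessLib
import Summits.NavierStokesRegularity.NavierStokesRegularity.Theorems.LocalSineTubeDoorGenericDoor
import Summits.NavierStokesRegularity.NavierStokesRegularity.Theorems.LocalSineTubeDoorSequentialDoor
import Summits.NavierStokesRegularity.NavierStokesRegularity.Theorems.LocalSineTubeDoorMostTimesCrossDoor
import Summits.NavierStokesRegularity.NavierStokesRegularity.Theorems.LocalSineTubeDoorMostTimesFixedDirectionDoor
import Summits.NavierStokesRegularity.NavierStokesRegularity.Theorems.PoloidalWindowDoorPoloidalWindowRigidityOneSlice

/-!
# The one-window door family — the ONE-DIRECTION-DERIVATIVE door («local two-dimensionalisation»), unconditional,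
# in the all-times, sequential and most-times forms

Cell ns-regularity-ideate, seat p6 (route-directed support for nsreg-p1's door family; anchor
`--supports stmt-NavierStokesRegularity-20017`; rung N0-LocalTubeDoorSine neighbourhood).  With the first-order scalar
`F(x, A) = ‖A e‖` (`e ≠ 0` fixed) — the directional derivative `∂ₑ u` — the ONE-SLICE profile crux is a tree theorem:
a Type-I profile with `∂ₑ v(s) = 0` on a nonempty open window of ONE slice `s < 0` has `∂ₑ v(s) ≡ 0` (slice
analyticity), i.e. the slice is invariant under translations along `e` (mean value theorem on the lines `y + ℝe`), and
then `v ≡ 0` by `…PoloidalWindowRigidityOneSlice.eq_zero_of_translate_eq_slice` (translation invariance of one slice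
propagates to all slices; ancient planar Liouville with the Type-I rate).  The templates then give, for a classical
Leray–Hopf solution on `[0,T)` from rapidly decaying data, LOCALLY Type I at `(x₀,T)`, `U` nonempty open, `e ≠ 0`:

* `localTubeDoorOneDirection` — `∫_U (T−t) ‖∂ₑ u(t, x₀ + √(T−t)y)‖ dy → 0` as `t → T⁻` ⇒ backward bounded at `x₀`;
* `sequentialOneDirectionDoor` — fading only along times `tₖ → T` with bounded gaps `T − tₖ₊₁ ≥ c (T − tₖ)` suffices;
* `mostTimesOneDirectionDoor` — fading along all times outside an exceptional set of density `→ 0` at `T` suffices.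

(`(T−t) ∂ₑu` is the scale-invariant normalisation.)  So LOCAL TWO-DIMENSIONALISATION — the flow becoming invariant along
one fixed direction on one similarity window, even only along a sparse sequence of times — rules out a locally Type-I
singularity.  Compare the printed GLOBAL one-direction criteria (`∂₃u ∈ L^p_t L^q_x`, Kukavica–Ziane 2007, Cao–Titi 2011):
here the hypothesis is local, scale-invariant, on one window, under local Type I.

WHAT THIS IS NOT: not a claim about Navier–Stokes regularity (Clay A) — local, conditional-on-Type-I regularity CRITERIA
(bears_on LADDER-NS N0); establishment in the cell's sense needs the cross-family referee PASS + independent reproduction.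
-/

noncomputable section

-- the summit and its single sub-problem share the name (CONVENTIONS §1), as in every Theorems file
set_option linter.dupNamespace false

namespace Summit.NavierStokesRegularity.NavierStokesRegularity.Theorems.LocalSineTubeDoorOneDirectionDoor

open MeasureTheory Set Function Filter Topology TopologicalSpace Metric
open scoped RealInnerProductSpace InnerProductSpace NNReal ENNReal
open Literature.Analysis Literature.Analysis.FluidPDE
open Summit.NavierStokesRegularity.NavierStokesRegularity.Theorems.LocalSineTubeDoorProfileAlignedWindowRigidityAncient
open Summit.NavierStokesRegularity.NavierStokesRegularity.Theorems.PoloidalWindowDoorPoloidalWindowRigidityFlat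
open Summit.NavierStokesRegularity.NavierStokesRegularity.Theorems.PoloidalWindowDoorPoloidalWindowRigidityOneSlice
open Summit.NavierStokesRegularity.NavierStokesRegularity.Theorems.LocalSineTubeDoorGenericDoor
open Summit.NavierStokesRegularity.NavierStokesRegularity.Theorems.LocalSineTubeDoorSequentialDoor
open Summit.NavierStokesRegularity.NavierStokesRegularity.Theorems.LocalSineTubeDoorMostTimesCrossDoor
open Summit.NavierStokesRegularity.NavierStokesRegularity.Theorems.LocalSineTubeDoorMostTimesFixedDirectionDoor

variable (e : EuclideanSpace ℝ (Fin 3))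

/-- The directional-derivative scalar `F(x, A) = ‖A e‖` is continuous in `(x, A)`. -/
theorem continuous_dirDerivNorm :
    Continuous fun q : EuclideanSpace ℝ (Fin 3) × (EuclideanSpace ℝ (Fin 3) →L[ℝ] EuclideanSpace ℝ (Fin 3)) =>
      ‖q.2 e‖ :=
  continuous_norm.comp ((ContinuousLinearMap.apply ℝ (EuclideanSpace ℝ (Fin 3)) e).continuous.comp continuous_snd)

/-- The zero set of `F(x, A) = ‖A e‖` is invariant under positive rescalings. -/
theorem dirDerivNorm_zeroSet_invariant :
    ∀ (a b : ℝ), 0 < a → 0 < b → ∀ (x : EuclideanSpace ℝ (Fin 3))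
      (A : EuclideanSpace ℝ (Fin 3) →L[ℝ] EuclideanSpace ℝ (Fin 3)), ‖(b • A) e‖ = 0 ↔ ‖A e‖ = 0 := by
  intro a b _ hb x A
  rw [_root_.smul_apply, norm_smul, mul_eq_zero, Real.norm_eq_abs, abs_eq_zero, or_iff_right hb.ne']

variable {e}

/-- A `C¹` field on `ℝ³` with `∂ₑ V ≡ 0` is invariant under translations along `e` (mean value theorem on the lines
`l ↦ y + l e`). -/
theorem translate_eq_of_fderiv_apply_eq_zero {V : EuclideanSpace ℝ (Fin 3) → EuclideanSpace ℝ (Fin 3)}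
    (hV : Differentiable ℝ V) (h : ∀ z, fderiv ℝ V z e = 0) (y : EuclideanSpace ℝ (Fin 3)) (l : ℝ) :
    V (y + l • e) = V y := by
  have hline : ∀ l : ℝ, HasDerivAt (fun l : ℝ => y + l • e) e l := fun l => by
    simpa using ((hasDerivAt_id l).smul_const e).const_add y
  have hderiv : ∀ l : ℝ, HasDerivAt (fun l : ℝ => V (y + l • e)) 0 l := fun l => by
    have hc := (hV (y + l • e)).hasFDerivAt.comp_hasDerivAt l (hline l)
    rwa [h] at hc
  have hconst := is_const_of_deriv_eq_zero (f := fun l : ℝ => V (y + l • e)) (fun l => (hderiv l).differentiableAt)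
    (fun l => (hderiv l).deriv) l 0
  simpa using hconst

/-- **The one-slice profile crux for the directional derivative**: a profile of the Type-I class with `∂ₑ v(s) = 0` on a
nonempty open window of ONE slice `s < 0` (`e ≠ 0`) is not backward-singular — `∂ₑ v(s) ≡ 0` by slice analyticity, so
the slice is translation-invariant along `e`, and `…OneSlice.eq_zero_of_translate_eq_slice` gives `v ≡ 0`. -/
theorem oneSliceCrux_dirDerivNorm (he : e ≠ 0) :
    ∀ (C : ℝ) (v : ℝ → EuclideanSpace ℝ (Fin 3) → EuclideanSpace ℝ (Fin 3)),
      Literature.Analysis.FluidPDE.HasTypeITimeDecay C v →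
      ContinuousOn (Function.uncurry v) (Set.Iio (0 : ℝ) ×ˢ Set.univ) →
      (∀ s t : ℝ, s < t → t < 0 → ∀ x, v t x =
        Literature.Analysis.UnboundedOperators.heatExtension (v s) (t - s) x -
          Literature.Analysis.FluidPDE.oseenDuhamel 1 s v v t x) →
      (∀ t < 0, Literature.Analysis.FluidPDE.VectorCalculus.IsDivFree (v t)) →
      (∃ s < 0, ∃ U : Set (EuclideanSpace ℝ (Fin 3)), IsOpen U ∧ U.Nonempty ∧
        ∀ z ∈ U, (fun (_ : EuclideanSpace ℝ (Fin 3)) (A : EuclideanSpace ℝ (Fin 3) →L[ℝ] EuclideanSpace ℝ (Fin 3)) =>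
          ‖A e‖) (v s z) (fderiv ℝ (v s) z) = 0) →
      ¬ Literature.Analysis.FluidPDE.IsBackwardSingularPoint v 0 := by
  intro C v hrate hcont hmild hdiv hwin
  obtain ⟨s, hs, U, hU, ⟨y₀, hy₀⟩, hzero⟩ := hwin
  have hslice : AnalyticOnNhd ℝ (v s) univ := analyticOnNhd_slice hcont (bdd_of_hasTypeITimeDecay hrate) hmild hs
  -- `z ↦ ∂ₑ v(s)(z)` is real-analytic and vanishes on `U`, hence everywhere
  have hD : AnalyticOnNhd ℝ (fun z => fderiv ℝ (v s) z e) univ := by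
    have h1 : AnalyticOnNhd ℝ (fderiv ℝ (v s)) univ := hslice.fderiv
    exact (ContinuousLinearMap.apply ℝ (EuclideanSpace ℝ (Fin 3)) e).comp_analyticOnNhd h1
  have hev : (fun z => fderiv ℝ (v s) z e) =ᶠ[𝓝 y₀] 0 :=
    Filter.eventually_of_mem (hU.mem_nhds hy₀) fun z hz => by simpa using hzero z hz
  have hall : ∀ z, fderiv ℝ (v s) z e = 0 := fun z =>
    hD.eqOn_zero_of_preconnected_of_eventuallyEq_zero isPreconnected_univ (mem_univ y₀) hev (mem_univ z)
  have hdiff : Differentiable ℝ (v s) := fun z => (hslice z (mem_univ z)).differentiableAt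
  exact not_backwardSingular_of_zero (eq_zero_of_translate_eq_slice hrate hcont hmild hdiv hs he
    (translate_eq_of_fderiv_apply_eq_zero hdiff hall))

/-- The all-slices form of the crux (for the all-times door template). -/
theorem windowCrux_dirDerivNorm (he : e ≠ 0) :
    ∀ (C : ℝ) (v : ℝ → EuclideanSpace ℝ (Fin 3) → EuclideanSpace ℝ (Fin 3)),
      Literature.Analysis.FluidPDE.HasTypeITimeDecay C v →
      ContinuousOn (Function.uncurry v) (Set.Iio (0 : ℝ) ×ˢ Set.univ) →
      (∀ s t : ℝ, s < t → t < 0 → ∀ x, v t x =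
        Literature.Analysis.UnboundedOperators.heatExtension (v s) (t - s) x -
          Literature.Analysis.FluidPDE.oseenDuhamel 1 s v v t x) →
      (∀ t < 0, Literature.Analysis.FluidPDE.VectorCalculus.IsDivFree (v t)) →
      (∀ s < 0, ∃ U : Set (EuclideanSpace ℝ (Fin 3)), IsOpen U ∧ U.Nonempty ∧
        ∀ z ∈ U, (fun (_ : EuclideanSpace ℝ (Fin 3)) (A : EuclideanSpace ℝ (Fin 3) →L[ℝ] EuclideanSpace ℝ (Fin 3)) =>
          ‖A e‖) (v s z) (fderiv ℝ (v s) z) = 0) →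
      ¬ Literature.Analysis.FluidPDE.IsBackwardSingularPoint v 0 :=
  fun C v hrate hcont hmild hdiv hwin =>
    oneSliceCrux_dirDerivNorm he C v hrate hcont hmild hdiv ⟨-1, by norm_num, hwin (-1) (by norm_num)⟩

/-- **THE ONE-DIRECTION-DERIVATIVE DOOR (all times, unconditional).**  See the module docstring. -/
theorem localTubeDoorOneDirection :
    ∀ (ν T : ℝ), 0 < ν → 0 < T → ∀ (u : ℝ → EuclideanSpace ℝ (Fin 3) → EuclideanSpace ℝ (Fin 3))
      (p : ℝ → EuclideanSpace ℝ (Fin 3) → ℝ),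
    Literature.Analysis.FluidPDE.IsClassicalNSSolutionOn (Set.Ico 0 T) ν 0 u p →
    Literature.Analysis.FluidPDE.IsLerayHopfOn T ν 0 (u 0) u →
    Literature.Analysis.FluidPDE.HasRapidSpatialDecay (u 0) →
    ∀ (x₀ : EuclideanSpace ℝ (Fin 3)) (ρ M : ℝ), 0 < ρ →
    (∀ t ∈ Set.Ico 0 T, T - ρ ^ 2 < t → ∀ x ∈ Metric.ball x₀ ρ, ‖u t x‖ * Real.sqrt (ν * (T - t)) ≤ M) →
    ∀ (e : EuclideanSpace ℝ (Fin 3)), e ≠ 0 →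
    ∀ (U : Set (EuclideanSpace ℝ (Fin 3))), IsOpen U → U.Nonempty →
    Filter.Tendsto (fun t => ∫⁻ y in U, ENNReal.ofReal
      ((T - t) * ‖fderiv ℝ (u t) (x₀ + Real.sqrt (T - t) • y) e‖)) (nhdsWithin T (Set.Iio T)) (nhds 0) →
    Literature.Analysis.FluidPDE.IsBackwardBoundedAt u T x₀ := by
  intro ν T hν hT u p hsol hLH hdec x₀ ρ M hρ hM e he U hU hUne hfade
  refine genericDoor_of_profileWindowRigidity (fun _ A => ‖A e‖) (continuous_dirDerivNorm e)
    (dirDerivNorm_zeroSet_invariant e) (windowCrux_dirDerivNorm he) ν T hν hT u p hsol hLH hdec x₀ ρ M hρ hM U hU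
    hUne ?_
  have hev : ∀ᶠ t in nhdsWithin T (Set.Iio T), t < T := eventually_nhdsWithin_of_forall fun t ht => ht
  refine hfade.congr' (hev.mono fun t ht => ?_)
  refine lintegral_congr fun y => ?_
  have hs : 0 ≤ T - t := (sub_pos.2 ht).le
  rw [_root_.smul_apply, norm_smul, Real.sq_sqrt hs, Real.norm_eq_abs, abs_of_nonneg hs,
    abs_of_nonneg (mul_nonneg hs (norm_nonneg _))]

/-- **THE SEQUENTIAL ONE-DIRECTION-DERIVATIVE DOOR (unconditional).**  See the module docstring. -/
theorem sequentialOneDirectionDoor :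
    ∀ (ν T : ℝ), 0 < ν → 0 < T → ∀ (u : ℝ → EuclideanSpace ℝ (Fin 3) → EuclideanSpace ℝ (Fin 3))
      (p : ℝ → EuclideanSpace ℝ (Fin 3) → ℝ),
    Literature.Analysis.FluidPDE.IsClassicalNSSolutionOn (Set.Ico 0 T) ν 0 u p →
    Literature.Analysis.FluidPDE.IsLerayHopfOn T ν 0 (u 0) u →
    Literature.Analysis.FluidPDE.HasRapidSpatialDecay (u 0) →
    ∀ (x₀ : EuclideanSpace ℝ (Fin 3)) (ρ M : ℝ), 0 < ρ →
    (∀ t ∈ Set.Ico 0 T, T - ρ ^ 2 < t → ∀ x ∈ Metric.ball x₀ ρ, ‖u t x‖ * Real.sqrt (ν * (T - t)) ≤ M) →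
    ∀ (e : EuclideanSpace ℝ (Fin 3)), e ≠ 0 →
    ∀ (U : Set (EuclideanSpace ℝ (Fin 3))), IsOpen U → U.Nonempty →
    ∀ (t : ℕ → ℝ) (c : ℝ), 0 < c → (∀ k, t k ∈ Set.Ico 0 T) → Filter.Tendsto t Filter.atTop (nhds T) →
    (∀ k, c * (T - t k) ≤ T - t (k + 1)) →
    Filter.Tendsto (fun k => ∫⁻ y in U, ENNReal.ofReal
      ((T - t k) * ‖fderiv ℝ (u (t k)) (x₀ + Real.sqrt (T - t k) • y) e‖)) Filter.atTop (nhds 0) →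
    Literature.Analysis.FluidPDE.IsBackwardBoundedAt u T x₀ := by
  intro ν T hν hT u p hsol hLH hdec x₀ ρ M hρ hM e he U hU hUne t c hc htk htT hgap hfade
  refine sequentialDoor_of_oneSliceWindowRigidity (fun _ A => ‖A e‖) (continuous_dirDerivNorm e)
    (dirDerivNorm_zeroSet_invariant e) (oneSliceCrux_dirDerivNorm he) ν T hν hT u p hsol hLH hdec x₀ ρ M hρ hM U hU
    hUne t c hc htk htT hgap ?_
  refine hfade.congr fun k => ?_
  refine lintegral_congr fun y => ?_
  have ht : 0 ≤ T - t k := (sub_pos.2 (htk k).2).le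
  rw [_root_.smul_apply, norm_smul, Real.sq_sqrt ht, Real.norm_eq_abs, abs_of_nonneg ht,
    abs_of_nonneg (mul_nonneg ht (norm_nonneg _))]

/-- **THE MOST-TIMES ONE-DIRECTION-DERIVATIVE DOOR (unconditional).**  See the module docstring. -/
theorem mostTimesOneDirectionDoor :
    ∀ (ν T : ℝ), 0 < ν → 0 < T → ∀ (u : ℝ → EuclideanSpace ℝ (Fin 3) → EuclideanSpace ℝ (Fin 3))
      (p : ℝ → EuclideanSpace ℝ (Fin 3) → ℝ),
    Literature.Analysis.FluidPDE.IsClassicalNSSolutionOn (Set.Ico 0 T) ν 0 u p →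
    Literature.Analysis.FluidPDE.IsLerayHopfOn T ν 0 (u 0) u →
    Literature.Analysis.FluidPDE.HasRapidSpatialDecay (u 0) →
    ∀ (x₀ : EuclideanSpace ℝ (Fin 3)) (ρ M : ℝ), 0 < ρ →
    (∀ t ∈ Set.Ico 0 T, T - ρ ^ 2 < t → ∀ x ∈ Metric.ball x₀ ρ, ‖u t x‖ * Real.sqrt (ν * (T - t)) ≤ M) →
    ∀ (e : EuclideanSpace ℝ (Fin 3)), e ≠ 0 →
    ∀ (U : Set (EuclideanSpace ℝ (Fin 3))), IsOpen U → U.Nonempty →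
    ∀ (E : Set ℝ), (∀ ε > 0, ∀ᶠ h in nhdsWithin (0 : ℝ) (Set.Ioi 0),
      MeasureTheory.volume (E ∩ Set.Ioo (T - h) T) ≤ ENNReal.ofReal (ε * h)) →
    (∀ t : ℕ → ℝ, (∀ k, t k ∈ Set.Ico 0 T ∧ t k ∉ E) → Filter.Tendsto t Filter.atTop (nhds T) →
      Filter.Tendsto (fun k => ∫⁻ y in U, ENNReal.ofReal
        ((T - t k) * ‖fderiv ℝ (u (t k)) (x₀ + Real.sqrt (T - t k) • y) e‖)) Filter.atTop (nhds 0)) →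
    Literature.Analysis.FluidPDE.IsBackwardBoundedAt u T x₀ := by
  intro ν T hν hT u p hsol hLH hdec x₀ ρ M hρ hM e he U hU hUne E hE hfadeE
  refine bandDoor_of_oneSliceWindowRigidity (fun _ A => ‖A e‖) (continuous_dirDerivNorm e)
    (dirDerivNorm_zeroSet_invariant e) (oneSliceCrux_dirDerivNorm he) ν T hν hT u p hsol hLH hdec x₀ ρ M hρ hM U hU
    hUne (fun t' => t' ∉ E) (1 / 2) (by norm_num) (band_of_densityZero hT hE) fun t htk htT => ?_
  refine (hfadeE t htk htT).congr fun k => ?_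
  refine lintegral_congr fun y => ?_
  have ht : 0 ≤ T - t k := (sub_pos.2 (htk k).1.2).le
  rw [_root_.smul_apply, norm_smul, Real.sq_sqrt ht, Real.norm_eq_abs, abs_of_nonneg ht,
    abs_of_nonneg (mul_nonneg ht (norm_nonneg _))]

end Summit.NavierStokesRegularity.NavierStokesRegularity.Theorems.LocalSineTubeDoorOneDirectionDoor

end
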